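import Literature.Probability.RandomPlanarGeometry.SLEImageDriverIncrement
import Literature.Probability.RandomPlanarGeometry.SLEImageDriverMeasurable
import Literature.Probability.RandomPlanarGeometry.SLERestrictionIncrementKappa
import HarnessLib

/-!
# The tilted martingale identities (line `boundary-area-law`, RS5b′/T2): good events, envelopes, locality

Line `boundary-area-law` of the crux `SubseqIdentification` (stmt-CriticalPhenomena-0783), restriction
reshape (lead c4), stub `stub_tiltedMartingales` = step (T2) of the tilted [LSW] Theorem 6.5
(G. F. Lawler, O. Schramm, W. Werner, *Conformal restriction: the chordal case*, J. Amer. Math. Soc.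
**16** (2003), §5 (5.1)–(5.3) and Prop. 5.3). Second helper file: the small measure-theoretic inputs
of the frozen one-step estimates of the mixed term `ΔW̃ · Ŷ′` (sub-step T2b of `RS5b-PLAN.md`):

* `goodEventK_eq_goodEvent`, `goodEvent_subset_goodEventK` — the good event `{σ sup|B| ≤ c₀}` of the
  `Y`-files (`SLERestrictionOneStep`) is the good event `{√κ sup|B| ≤ c₀√κ/σ}` of the `W̃`-files
  (`SLEImageDriverOneStep`), and the two step sizes compare by the factor `σ/√κ ≥ 1` (`κ ≤ 8/3`);
* `abs_imageDrvFnK_brownianCPath_sub_leK`, `integrable_imageDrv_subK` — the envelope of the increment of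
  `imageDrvFnK κ A` along the Brownian path for general `κ` (the tree has `κ = 6`,
  `SLEImageDriverEnvelope`), whence measurability and integrability of the increment and its square;
* `abs_imageDrvFnK_concat_sub_le_of_abs_le` — the envelope of the FROZEN increment with a bounded past
  `|W| ≤ N` on `[0, u]` (as before the localising time `imgLocTimeK`): a deterministic level
  `3482 N + 15080 √(u+h) + 1160 R` plus `3482 √κ sup_{[0,h]}|B(ω₂)|`;
* `DFnK_concat_stop_eq` — locality at the freezing time: the frozen path `concat_u(stop_u p, q)` has at
  time `u` the same hulls, the same slid hull and the same `D_u = Φ′_{A_u − W_u}(0) 𝟙{alive}` as `p`.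

References: [LSW] §5. No named fact is used.
-/

noncomputable section

open MeasureTheory Filter Topology Set Metric Function
open scoped NNReal ENNReal
open Literature.Probability.RandomPlanarGeometry
open Literature.Probability.Process (preWienerMeasure runSup runSup_nonneg integrable_runSup integrable_runSup_sq)

namespace Summit.CriticalPhenomena.SAWScalingLimit.Theorems.SubseqIdentification.BoundaryAreaLaw

open Loewner PathOps

/-! ### The two good events -/

section Good

/-- **The good event of the `Y`-files is a good event of the `W̃`-files**:
`{σ sup_{[0,h]}|B| ≤ c₀} = {√κ sup_{[0,h]}|B| ≤ c₀ √κ/σ}` (`κ > 0`). [folklore] -/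
theorem goodEventK_eq_goodEvent {κ : ℝ≥0} (hκ : 0 < κ) (δ₀ ρ₀ : ℝ) (h : ℝ≥0) :
    goodEventK κ (δ₀ * ρ₀ / 4000 * (Real.sqrt κ / stepSigma)) h =
      Literature.Probability.RandomPlanarGeometry.goodEvent δ₀ ρ₀ h := by
  have hs : 0 < Real.sqrt κ := Real.sqrt_pos.2 (by exact_mod_cast hκ)
  have hσ := stepSigma_pos
  ext ω
  simp only [goodEventK, Literature.Probability.RandomPlanarGeometry.goodEvent, mem_setOf_eq]
  rw [show δ₀ * ρ₀ / 4000 * (Real.sqrt κ / stepSigma) = (δ₀ * ρ₀ / 4000 / stepSigma) * Real.sqrt κ by ring,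
    mul_comm (Real.sqrt κ), mul_le_mul_iff_left₀ hs, le_div_iff₀ hσ, mul_comm]

/-- On the good event of the `Y`-files, `√κ sup|B| ≤ c₀` as well (`κ ≤ 8/3`), and the two step sizes
compare: `stepSize (σ sup|B|) h ≤ (σ/√κ) · stepSize (√κ sup|B|) h` (`κ > 0`). [folklore] -/
theorem goodEvent_subset_goodEventK {κ : ℝ≥0} (hκ0 : 0 < κ) (hκ : κ ≤ 8 / 3) (δ₀ ρ₀ : ℝ) (h : ℝ≥0)
    {ω : ℝ≥0 → ℝ} (hω : ω ∈ Literature.Probability.RandomPlanarGeometry.goodEvent δ₀ ρ₀ h) :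
    ω ∈ goodEventK κ (δ₀ * ρ₀ / 4000) h ∧
      stepSize (stepSigma * runSup h ω) h ≤ stepSigma / Real.sqrt κ * stepSize (Real.sqrt κ * runSup h ω) h ∧
      1 ≤ stepSigma / Real.sqrt κ := by
  have hs : 0 < Real.sqrt κ := Real.sqrt_pos.2 (by exact_mod_cast hκ0)
  have hσ := stepSigma_pos
  have hle := sqrt_le_stepSigma hκ
  have hX := runSup_nonneg h ω
  have hω' : stepSigma * runSup h ω ≤ δ₀ * ρ₀ / 4000 := hω
  have hratio : 1 ≤ stepSigma / Real.sqrt κ := by rw [le_div_iff₀ hs, one_mul]; exact hle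
  refine ⟨?_, ?_, hratio⟩
  · show Real.sqrt κ * runSup h ω ≤ δ₀ * ρ₀ / 4000
    exact (mul_le_mul_of_nonneg_right hle hX).trans hω'
  · rw [stepSize, stepSize, mul_add]
    have e1 : stepSigma / Real.sqrt κ * (Real.sqrt κ * runSup h ω) = stepSigma * runSup h ω := by
      field_simp
    rw [e1]
    have : 4 * Real.sqrt h ≤ stepSigma / Real.sqrt κ * (4 * Real.sqrt h) := by
      have h4 : 0 ≤ 4 * Real.sqrt (h : ℝ) := by positivity
      nlinarith
    linarith

end Good

/-! ### Envelopes of the increment of `imageDrvFnK κ A` for general `κ` -/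

section Envelope

variable {κ : ℝ≥0} {A : Set ℂ} {R : ℝ}

/-- **Envelope of the increment along the Brownian path** (any `κ`):
`|ΔimageDrvFnK(β(ω))| ≤ 3482√κ · runSup (u + h) ω + 15080 √(u + h) + 1160 R`. [folklore] -/
theorem abs_imageDrvFnK_brownianCPath_sub_leK (hA : IsStarHull A) (hR0 : 0 < R) (hAR : A ⊆ closedBall (0 : ℂ) R)
    (u h : ℝ≥0) (ω : ℝ≥0 → ℝ) :
    |imageDrvFnK κ A (u + h) (brownianCPath ω) - imageDrvFnK κ A u (brownianCPath ω)| ≤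
      3482 * Real.sqrt κ * runSup (u + h) ω + (15080 * Real.sqrt ((u + h : ℝ≥0) : ℝ) + 1160 * R) := by
  set M : ℝ := Real.sqrt κ * runSup (u + h) ω with hM
  have hM0 : 0 ≤ M := by have := runSup_nonneg (u + h) ω; positivity
  have hb1 : ∀ s : ℝ≥0, s ≤ u + h → |drvK κ (brownianCPath ω) s| ≤ M := fun s hs ↦ abs_drvK_brownianCPath_le κ hs ω
  have e1 := abs_imageDrvFnK_le_of_abs_le (κ := κ) (t := u + h) (υ := brownianCPath ω) hA hR0 hAR hM0 hb1
  have e2 := abs_imageDrvFnK_le_of_abs_le (κ := κ) (t := u) (υ := brownianCPath ω) hA hR0 hAR hM0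
    fun s hs ↦ hb1 s (hs.trans le_self_add)
  have hsq : Real.sqrt (u : ℝ) ≤ Real.sqrt ((u + h : ℝ≥0) : ℝ) := Real.sqrt_le_sqrt (by exact_mod_cast le_self_add)
  calc _ ≤ |imageDrvFnK κ A (u + h) (brownianCPath ω)| + |imageDrvFnK κ A u (brownianCPath ω)| := abs_sub _ _
    _ ≤ (M + 580 * (3 * M + 13 * Real.sqrt ((u + h : ℝ≥0) : ℝ) + R)) + (M + 580 * (3 * M + 13 * Real.sqrt (u : ℝ) + R)) :=
        add_le_add e1 e2
    _ ≤ _ := by rw [hM]; nlinarith [hsq]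

/-- The driver of the frozen path `concat_u(stop_u β(ω), β(ω₂))` on `[0, u + h]` is dominated by
`N + √κ runSup h ω₂` when the past driver is dominated by `N` on `[0, u]`. [folklore] -/
theorem abs_drvK_concat_le_of_abs_le {u h : ℝ≥0} {ω : ℝ≥0 → ℝ} {N : ℝ}
    (hN : ∀ s : ℝ≥0, s ≤ u → |drvK κ (brownianCPath ω) s| ≤ N) {s : ℝ≥0} (hs : s ≤ u + h) (ω₂ : ℝ≥0 → ℝ) :
    |drvK κ (concat u (stop u (brownianCPath ω), brownianCPath ω₂)) s| ≤ N + Real.sqrt κ * runSup h ω₂ := by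
  have h0h := runSup_nonneg h ω₂
  have hs0 := Real.sqrt_nonneg (κ : ℝ)
  rcases le_or_gt s u with hsu | hus
  · rw [drvK_concat_of_le _ _ hsu, drvK_stop_of_le κ _ hsu]
    have := hN s hsu
    nlinarith [mul_nonneg hs0 h0h]
  · obtain ⟨r, rfl⟩ : ∃ r, s = u + r := ⟨s - u, (add_tsub_cancel_of_le hus.le).symm⟩
    have hr : r ≤ h := le_of_add_le_add_left hs
    have h1 := drvK_concat_add_sub (κ := κ) (u := u) (stop u (brownianCPath ω)) (brownianCPath ω₂) (brownianCPath_zero ω₂) r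
    have h2 : drvK κ (concat u (stop u (brownianCPath ω), brownianCPath ω₂)) u = drvK κ (brownianCPath ω) u := by
      rw [drvK_concat_of_le _ _ le_rfl, drvK_stop_of_le κ _ le_rfl]
    have h3 : drvK κ (concat u (stop u (brownianCPath ω), brownianCPath ω₂)) (u + r) =
        drvK κ (brownianCPath ω) u + Real.sqrt κ * Literature.Probability.Process.brownian r ω₂ := by
      rw [h2, brownianCPath_apply] at h1; linarith
    rw [h3]
    have e1 := hN u le_rfl
    have e2 : |Real.sqrt κ * Literature.Probability.Process.brownian r ω₂| ≤ Real.sqrt κ * runSup h ω₂ := by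
      rw [abs_mul, abs_of_nonneg hs0]
      exact mul_le_mul_of_nonneg_left (Literature.Probability.Process.abs_brownian_le_runSup hr ω₂) hs0
    exact (abs_add_le _ _).trans (add_le_add e1 e2)

/-- **Envelope of the frozen increment with a bounded past** (any `κ`): if `|W_s| ≤ N` on `[0, u]`, then
`|ΔimageDrvFnK(concat_u(stop_u β(ω), β(ω₂)))| ≤ (3482 N + 15080 √(u+h) + 1160 R) + 3482√κ runSup h ω₂` —
a DETERMINISTIC envelope level (before the localising time the driver is bounded). [folklore] -/
theorem abs_imageDrvFnK_concat_sub_le_of_abs_le (hA : IsStarHull A) (hR0 : 0 < R) (hAR : A ⊆ closedBall (0 : ℂ) R)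
    {u h : ℝ≥0} {ω : ℝ≥0 → ℝ} {N : ℝ} (hN0 : 0 ≤ N) (hN : ∀ s : ℝ≥0, s ≤ u → |drvK κ (brownianCPath ω) s| ≤ N)
    (ω₂ : ℝ≥0 → ℝ) :
    |imageDrvFnK κ A (u + h) (concat u (stop u (brownianCPath ω), brownianCPath ω₂)) -
        imageDrvFnK κ A u (concat u (stop u (brownianCPath ω), brownianCPath ω₂))| ≤
      (3482 * N + (15080 * Real.sqrt ((u + h : ℝ≥0) : ℝ) + 1160 * R)) + 3482 * Real.sqrt κ * runSup h ω₂ := by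
  set υ := concat u (stop u (brownianCPath ω), brownianCPath ω₂) with hυ
  set M : ℝ := N + Real.sqrt κ * runSup h ω₂ with hM
  have hX2 := runSup_nonneg h ω₂
  have hs0 := Real.sqrt_nonneg (κ : ℝ)
  have hM0 : 0 ≤ M := by positivity
  have hb1 : ∀ s : ℝ≥0, s ≤ u + h → |drvK κ υ s| ≤ M := fun s hs ↦ abs_drvK_concat_le_of_abs_le hN hs ω₂
  have e1 := abs_imageDrvFnK_le_of_abs_le (κ := κ) (t := u + h) (υ := υ) hA hR0 hAR hM0 hb1
  have e2 := abs_imageDrvFnK_le_of_abs_le (κ := κ) (t := u) (υ := υ) hA hR0 hAR hM0 fun s hs ↦ hb1 s (hs.trans le_self_add)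
  have hsq : Real.sqrt (u : ℝ) ≤ Real.sqrt ((u + h : ℝ≥0) : ℝ) := Real.sqrt_le_sqrt (by exact_mod_cast le_self_add)
  calc _ ≤ |imageDrvFnK κ A (u + h) υ| + |imageDrvFnK κ A u υ| := abs_sub _ _
    _ ≤ (M + 580 * (3 * M + 13 * Real.sqrt ((u + h : ℝ≥0) : ℝ) + R)) + (M + 580 * (3 * M + 13 * Real.sqrt (u : ℝ) + R)) :=
        add_le_add e1 e2
    _ ≤ _ := by rw [hM]; nlinarith [hsq, mul_nonneg hs0 hX2]

/-- The increment functional is measurable, and it and its square are integrable along the Brownian path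
(any `κ`, nonempty `A`). [folklore] -/
theorem integrable_imageDrv_subK [MeasurableSpace C(ℝ≥0, ℝ)] [BorelSpace C(ℝ≥0, ℝ)] (hA : IsStarHull A) (hne : A.Nonempty)
    (hR0 : 0 < R) (hAR : A ⊆ closedBall (0 : ℂ) R) (u h : ℝ≥0) :
    Measurable (fun υ : C(ℝ≥0, ℝ) ↦ imageDrvFnK κ A (u + h) υ - imageDrvFnK κ A u υ) ∧
    Integrable (fun ω ↦ imageDrvFnK κ A (u + h) (brownianCPath ω) - imageDrvFnK κ A u (brownianCPath ω)) preWienerMeasure ∧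
      Integrable (fun ω ↦ (imageDrvFnK κ A (u + h) (brownianCPath ω) - imageDrvFnK κ A u (brownianCPath ω)) ^ 2)
        preWienerMeasure := by
  set Φ : C(ℝ≥0, ℝ) → ℝ := fun υ ↦ imageDrvFnK κ A (u + h) υ - imageDrvFnK κ A u υ with hΦ
  have hΦm : Measurable Φ := (measurable_imageDrvFnK κ hA hne _).sub (measurable_imageDrvFnK κ hA hne _)
  set M₁ : ℝ := 3482 * Real.sqrt κ with hM₁
  set Q : ℝ := 15080 * Real.sqrt ((u + h : ℝ≥0) : ℝ) + 1160 * R with hQ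
  have hΦβ : ∀ ω, |Φ (brownianCPath ω)| ≤ M₁ * runSup (u + h) ω + Q := fun ω ↦
    abs_imageDrvFnK_brownianCPath_sub_leK hA hR0 hAR u h ω
  have hΦβm : Measurable fun ω ↦ Φ (brownianCPath ω) := hΦm.comp measurable_brownianCPath
  refine ⟨hΦm, (((integrable_runSup (u + h)).const_mul M₁).add (integrable_const Q)).mono' hΦβm.aestronglyMeasurable
      (Eventually.of_forall fun ω ↦ by rw [Real.norm_eq_abs]; exact hΦβ ω), ?_⟩
  refine ((((integrable_runSup_sq (u + h)).const_mul (2 * M₁ ^ 2)).add (integrable_const (2 * Q ^ 2))).mono'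
    (hΦβm.pow_const 2).aestronglyMeasurable (Eventually.of_forall fun ω ↦ ?_))
  rw [Real.norm_eq_abs, abs_of_nonneg (sq_nonneg _), Pi.add_apply]
  have h2 : Φ (brownianCPath ω) ^ 2 ≤ (M₁ * runSup (u + h) ω + Q) ^ 2 := by
    rw [← sq_abs]; exact pow_le_pow_left₀ (abs_nonneg _) (hΦβ ω) 2
  nlinarith [sq_nonneg (M₁ * runSup (u + h) ω - Q)]

end Envelope

/-! ### Locality at the freezing time -/

section Locality

variable {κ : ℝ≥0} {A : Set ℂ}

/-- **Locality at the freezing time**: the frozen path `concat_u(stop_u p, q)` agrees with `p` on `[0, u]`,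
so (when `p` is alive at `u`) it is alive at `u`, has the same slid hull `A_u − W_u`, and the same
`D_u = Φ′_{A_u − W_u}(0) 𝟙{alive}`. [folklore] -/
theorem DFnK_concat_stop_eq (hA : IsStarHull A) {u : ℝ≥0} {p : C(ℝ≥0, ℝ)} (halive : Disjoint (closedHull (drvK κ p) u) A)
    (q : C(ℝ≥0, ℝ)) :
    Disjoint (closedHull (drvK κ (concat u (stop u p, q))) u) A ∧
      slidHull (drvK κ (concat u (stop u p, q))) A u = slidHull (drvK κ p) A u ∧
      DFnK κ A u (concat u (stop u p, q)) = starDeriv (slidHull (drvK κ p) A u) := by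
  set υ := concat u (stop u p, q) with hυ
  have hW := continuous_drvK κ p
  have hW' := continuous_drvK κ υ
  have heq : ∀ s, s ≤ u → drvK κ p s = drvK κ υ s := fun s hs ↦ by
    rw [hυ, drvK_concat_of_le _ _ hs, drvK_stop_of_le κ p hs]
  have hcl : closedHull (drvK κ υ) u = closedHull (drvK κ p) u := (closedHull_eq_of_eqOn hW hW' heq).symm
  have halive' : Disjoint (closedHull (drvK κ υ) u) A := by rw [hcl]; exact halive
  have hsl : slidHull (drvK κ υ) A u = slidHull (drvK κ p) A u :=
    slidHull_eq_of_eqOn hW hW' heq fun a ha ↦ lt_swallowingTime_of_alive hA halive ha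
  exact ⟨halive', hsl, by rw [(DFnK_eq (κ := κ) (A := A) u υ).1 halive', hsl]⟩

end Locality

section Registered

/-- **Registered form** (explicit binders) of `goodEventK_eq_goodEvent`: the good event of the
`Y`-files is the good event `{√κ sup|B| ≤ c₀√κ/σ}` of the `W̃`-files. [folklore] -/
theorem goodEventK_eq_goodEvent_registered :
    ∀ (κ : ℝ≥0), 0 < κ → ∀ (δ₀ ρ₀ : ℝ) (h : ℝ≥0),
      goodEventK κ (δ₀ * ρ₀ / 4000 * (Real.sqrt κ / stepSigma)) h =
        Literature.Probability.RandomPlanarGeometry.goodEvent δ₀ ρ₀ h :=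
  fun _ hκ δ₀ ρ₀ h ↦ goodEventK_eq_goodEvent hκ δ₀ ρ₀ h

end Registered

end Summit.CriticalPhenomena.SAWScalingLimit.Theorems.SubseqIdentification.BoundaryAreaLaw

end
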